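import Literature.MathematicalPhysics.QuantumLattice.HubbardGridScaleCovariances
import Literature.MathematicalPhysics.QuantumLattice.MatsubaraTruncationRemainder
import Literature.MathematicalPhysics.QuantumLattice.TorusShellCounting
import Mathlib.Analysis.Calculus.MeanValue
import HarnessLib

/-!
# The total tadpole of the shifted Hubbard covariance as a function of the complex chemical-potential shift:
# `|T| ≤ 1/2` on the real axis and a logarithmic Lipschitz constant in the strip

Topic `MathematicalPhysics/QuantumLattice`; cell gate-hubbard-kl, R0-SCOPE-4 W7 (the Hartree shift).  The sum of the scale tadpoles of
`HubbardGridScaleCovariances` does not see the partition of unity: `Σ_{j ≤ K} t_j = T(s)`,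
`T(s) = -(βL²)⁻¹ Σ_{n,k⃗} 1/(-iω_n + ξ_μ(k⃗) - s)` at `s = (μ_R - μ) + iθ` (`sum_gridScaleTadpole_eq_totalTadpole`).  On the real axis the
pairing `ω ↔ -ω` gives `|T(s₁)| ≤ 1/2` (`norm_totalTadpole_ofReal_le`; BGM (2.21)–(2.22): the tadpole is the free density, bounded); in the
strip `|Im s| ≤ π/(4β)` the derivative `T′(s) = -(βL²)⁻¹ Σ 1/(-iω_n + ξ - s)²` is bounded by `(16/9) L⁻² Σ_{k⃗} min(β/2|ξ′|, β²/3)·β⁻¹`, which the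
shell counting of `TorusShellCounting` turns into `A + B log β + (20/3) β/L` (`norm_totalTadpoleDeriv_le`, `shellWeightSum_le`), whence the
Lipschitz bound `‖T(s) - T(s′)‖ ≤ Lip · ‖s - s′‖` on the box `|Re| ≤ δ`, `|Im| ≤ π/(4β)` (`norm_totalTadpole_sub_le`).  This is what makes two
Picard iterations of the Hartree condition `μ″ = μ - u/2 - uT(μ″ - μ)` accurate to `O(|u|³ Lip²)`.

Everything is proved; `totalTadpole`, `totalTadpoleDeriv`, `shellWeight` are the only definitions; no named facts.

## Sources

G. Benfatto, A. Giuliani, V. Mastropietro, Ann. Henri Poincaré 7 (2006) 809–898, §2.3 (2.21)–(2.24), §2.1 (2.2)–(2.5)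
(`BenfattoGiulianiMastropietro2006`).
-/

noncomputable section

namespace Literature.MathematicalPhysics.QuantumLattice

open Literature.Probability.LatticeModels Finset Complex

/-- **The total tadpole** `T(s) = -(βL²)⁻¹ Σ_{n,k⃗} 1/(-iω_n + ξ_μ(k⃗) - s)` as a function of the complex shift `s` of the chemical
potential. [cite: BenfattoGiulianiMastropietro2006, §2.3 (2.21)-(2.22)] -/
def totalTadpole (L M : ℕ) [NeZero L] (β μ : ℝ) (s : ℂ) : ℂ :=
  -∑ k : FreqMomentum L M, ((1 / (β * (L : ℝ) ^ 2) : ℝ) : ℂ) / (-I * (matsubaraFreq β M k.1 : ℂ) + (nambuXi L μ k.2 : ℂ) - s)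

/-- Its derivative `T′(s) = -(βL²)⁻¹ Σ 1/(-iω_n + ξ - s)²`. [cite: BenfattoGiulianiMastropietro2006, §2.3 (2.21)-(2.22)] -/
def totalTadpoleDeriv (L M : ℕ) [NeZero L] (β μ : ℝ) (s : ℂ) : ℂ :=
  -∑ k : FreqMomentum L M, ((1 / (β * (L : ℝ) ^ 2) : ℝ) : ℂ) / (-I * (matsubaraFreq β M k.1 : ℂ) + (nambuXi L μ k.2 : ℂ) - s) ^ 2

/-- The weight of a momentum in the derivative bound: `β/3` inside `|ξ| < 3/(2β)`, `1/(2|ξ|)` outside.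
[cite: BenfattoGiulianiMastropietro2006, §2.1 (2.2)-(2.5)] -/
def shellWeight (L : ℕ) [NeZero L] (β μ : ℝ) (k : TorusSite 2 L) : ℝ :=
  if |nambuXi L μ k| < 3 / (2 * β) then β / 3 else 1 / (2 * |nambuXi L μ k|)

variable {L M N : ℕ} [NeZero L]

omit [NeZero L] in
/-- The denominators do not vanish in the open strip `|Im s| < π/β`. [cite: BenfattoGiulianiMastropietro2006, §2.1 (2.3)] -/
theorem totalDen_ne_zero {β : ℝ} (hβ : 0 < β) (μ : ℝ) {s : ℂ} (hs : |s.im| < Real.pi / β) (k : FreqMomentum L M) :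
    -I * (matsubaraFreq β M k.1 : ℂ) + (nambuXi L μ k.2 : ℂ) - s ≠ 0 := by
  intro h
  have him := congrArg Complex.im h
  simp at him
  have hω := pi_div_le_abs_matsubaraFreq hβ k.1
  have : |matsubaraFreq β M k.1| = |s.im| := by rw [show matsubaraFreq β M k.1 = -s.im by linarith, abs_neg]
  linarith

/-! ### The scale tadpoles resum to the total tadpole -/

/-- The symbols of all steps sum to the full shifted symbol (the weights telescope to `w_{Λ_K} = 1`, `Λ_K = π/β`).
[cite: BenfattoGiulianiMastropietro2006, §2.2 (2.9)-(2.11)] -/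
theorem sum_gridScaleSymbol_eq {β : ℝ} (hβ : 0 < β) (μR θ Λ₀ r : ℝ) {K : ℕ} (hK : K ≠ 0) (ks : FreqMomentum L M × Fin 2) :
    ∑ j ∈ range (K + 1), gridScaleSymbol L M β μR θ Λ₀ r K j ks = shiftedFreeSymbol L M β μR θ ks := by
  rw [sum_range_succ']
  have h0 : gridScaleSymbol L M β μR θ Λ₀ r K 0 ks = ((hubbardCutoffWeight L M β μR Λ₀ ks.1 : ℝ) : ℂ) * shiftedFreeSymbol L M β μR θ ks := by
    simp [gridScaleSymbol, uvShiftedSymbol]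
  have hj : ∀ j ∈ range K, gridScaleSymbol L M β μR θ Λ₀ r K (j + 1) ks =
      (((hubbardCutoffWeight L M β μR (gridScale β Λ₀ r K (j + 1)) ks.1 : ℝ) : ℂ) -
        ((hubbardCutoffWeight L M β μR (gridScale β Λ₀ r K j) ks.1 : ℝ) : ℂ)) * shiftedFreeSymbol L M β μR θ ks := by
    intro j hjm
    have : j + 1 ≤ K := by have := mem_range.1 hjm; omega
    simp [gridScaleSymbol, this, shiftedSliceSymbol]
  rw [h0, sum_congr rfl hj, ← sum_mul, ← add_mul, Finset.sum_range_sub (fun j => ((hubbardCutoffWeight L M β μR (gridScale β Λ₀ r K j) ks.1 : ℝ) : ℂ)),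
    gridScale_zero, gridScale_last β Λ₀ r hK, hubbardCutoffWeight_eq_one_of_le hβ μR (by positivity) le_rfl]
  push_cast
  ring

omit [NeZero L] in
/-- The shifted symbol is `βL²` over the denominator of the total tadpole at `s = (μ_R - μ) + iθ` (`|βθ| ≤ π/4`).
[cite: BenfattoGiulianiMastropietro2006, §2.1 (2.3)] -/
theorem shiftedFreeSymbol_eq_div_totalDen {β : ℝ} (hβ : 0 < β) (μ μR : ℝ) {θ : ℝ} (hθ : |β * θ| ≤ Real.pi / 4)
    (ks : FreqMomentum L M × Fin 2) :
    shiftedFreeSymbol L M β μR θ ks =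
      ((β * (L : ℝ) ^ 2 : ℝ) : ℂ) / (-I * (matsubaraFreq β M ks.1.1 : ℂ) + (nambuXi L μ ks.1.2 : ℂ) - (((μR - μ : ℝ) : ℂ) + θ * I)) := by
  have hden : (matsubaraFreq β M ks.1.1 + θ) ^ 2 + nambuXi L μR ks.1.2 ^ 2 ≠ 0 := by
    have hω := pi_div_le_abs_matsubaraFreq hβ ks.1.1
    have hθ' : |θ| < Real.pi / β := by
      rw [abs_mul, abs_of_pos hβ] at hθ
      rw [lt_div_iff₀ hβ]; nlinarith [Real.pi_pos, abs_nonneg θ]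
    intro h
    have h1 : matsubaraFreq β M ks.1.1 + θ = 0 := by nlinarith [sq_nonneg (nambuXi L μR ks.1.2)]
    have : |matsubaraFreq β M ks.1.1| = |θ| := by rw [show matsubaraFreq β M ks.1.1 = -θ by linarith, abs_neg]
    linarith
  rw [shiftedFreeSymbol_eq_div β μR θ ks hden]
  congr 1
  simp only [nambuXi]
  push_cast
  ring

/-- **`Σ_{j ≤ K} t_j = T((μ_R - μ) + iθ)`** (`0 < β`, `K ≠ 0`, `|βθ| ≤ π/4`). [cite: BenfattoGiulianiMastropietro2006, §2.3 (2.21)-(2.22)] -/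
theorem sum_gridScaleTadpole_eq_totalTadpole {β : ℝ} (hβ : 0 < β) (μ μR : ℝ) {θ : ℝ} (hθ : |β * θ| ≤ Real.pi / 4) (Λ₀ r : ℝ)
    {K : ℕ} (hK : K ≠ 0) :
    ∑ j ∈ range (K + 1), gridScaleTadpole L M β μR θ Λ₀ r K j = totalTadpole L M β μ (((μR - μ : ℝ) : ℂ) + θ * I) := by
  have hL : (L : ℂ) ≠ 0 := by exact_mod_cast NeZero.ne L
  have hβ' : (β : ℂ) ≠ 0 := by exact_mod_cast hβ.ne'
  have hθ' : |θ| < Real.pi / β := by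
    rw [abs_mul, abs_of_pos hβ] at hθ
    rw [lt_div_iff₀ hβ]; nlinarith [Real.pi_pos, abs_nonneg θ]
  have him : |(((μR - μ : ℝ) : ℂ) + θ * I).im| < Real.pi / β := by simpa using hθ'
  unfold totalTadpole gridScaleTadpole
  rw [Finset.sum_neg_distrib, neg_inj, sum_comm]
  refine sum_congr rfl fun k _ => ?_
  rw [← mul_sum, sum_gridScaleSymbol_eq hβ μR θ Λ₀ r hK, shiftedFreeSymbol_eq_div_totalDen hβ μ μR hθ]
  have hden := totalDen_ne_zero (L := L) (M := M) hβ μ him k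
  rw [div_eq_mul_inv, div_eq_mul_inv, ← mul_assoc]
  congr 1
  push_cast
  field_simp

/-! ### The bound on the real axis -/

/-- **`|T(s₁)| ≤ 1/2` for real shifts** (`0 < β`): pairing `ω ↔ -ω` turns the frequency sum into `Σ_n 2ξ′/(ω_n²+ξ′²)`, `|·| ≤ β/2`.
[cite: BenfattoGiulianiMastropietro2006, §2.3 (2.21)-(2.22)] -/
theorem norm_totalTadpole_ofReal_le {β : ℝ} (hβ : 0 < β) (μ s₁ : ℝ) : ‖totalTadpole L M β μ (s₁ : ℂ)‖ ≤ 1 / 2 := by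
  have hL : (0 : ℝ) < L := by exact_mod_cast Nat.pos_of_ne_zero (NeZero.ne L)
  have hc : ‖((1 / (β * (L : ℝ) ^ 2) : ℝ) : ℂ)‖ = 1 / (β * (L : ℝ) ^ 2) := by
    rw [Complex.norm_real, Real.norm_eq_abs, abs_of_pos (by positivity)]
  -- the frequency sum at fixed momentum
  have hfreq : ∀ kv : TorusSite 2 L,
      ‖∑ i : MatsubaraIdx M, (1 : ℂ) / (-I * (matsubaraFreq β M i : ℂ) + (nambuXi L μ kv : ℂ) - (s₁ : ℂ))‖ ≤ β / 2 := by
    intro kv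
    set ξ' : ℝ := nambuXi L μ kv - s₁ with hξ'
    have hrw : ∀ ω : ℝ, (1 : ℂ) / (-I * (ω : ℂ) + (nambuXi L μ kv : ℂ) - (s₁ : ℂ)) = 1 / (-I * (ω : ℂ) + (ξ' : ℂ)) := by
      intro ω; rw [hξ']; push_cast; ring_nf
    simp_rw [hrw]
    rw [sum_matsubaraIdx_freq_eq_sum_range β M (fun ω => (1 : ℂ) / (-I * (ω : ℂ) + (ξ' : ℂ))), ← sum_add_distrib]
    -- each pair is `2ξ′/(ω²+ξ′²)`
    have hpair : ∀ n : ℕ, (1 : ℂ) / (-I * (((2 * n + 1) * Real.pi / β : ℝ) : ℂ) + (ξ' : ℂ)) +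
        1 / (-I * ((-((2 * n + 1) * Real.pi / β) : ℝ) : ℂ) + (ξ' : ℂ)) =
        ((2 * ξ' / (((2 * n + 1) * Real.pi / β) ^ 2 + ξ' ^ 2) : ℝ) : ℂ) := by
      intro n
      set ω : ℝ := (2 * n + 1) * Real.pi / β with hω
      have hω0 : 0 < ω := by rw [hω]; positivity
      have h1 : (-I * (ω : ℂ) + (ξ' : ℂ)) ≠ 0 := by
        intro h; have := congrArg Complex.im h; simp at this; exact hω0.ne' this
      have h2 : (-I * ((-ω : ℝ) : ℂ) + (ξ' : ℂ)) ≠ 0 := by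
        intro h; have := congrArg Complex.im h; simp at this; exact hω0.ne' this
      have hD : (0 : ℝ) < ω ^ 2 + ξ' ^ 2 := by positivity
      have hden : ((ω ^ 2 + ξ' ^ 2 : ℝ) : ℂ) ≠ 0 := by exact_mod_cast hD.ne'
      have key : (-I * (ω : ℂ) + (ξ' : ℂ)) * (-I * ((-ω : ℝ) : ℂ) + (ξ' : ℂ)) = ((ω ^ 2 + ξ' ^ 2 : ℝ) : ℂ) := by
        push_cast; ring_nf; rw [Complex.I_sq]; ring
      rw [div_add_div _ _ h1 h2, one_mul, mul_one, key]
      push_cast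
      field_simp
      ring
    simp_rw [hpair]
    rw [← Complex.ofReal_sum, Complex.norm_real, Real.norm_eq_abs]
    refine (abs_sum_le_sum_abs _ _).trans ?_
    by_cases hξ0 : ξ' = 0
    · simp [hξ0]; positivity
    · have habs : ∀ n ∈ range M, |2 * ξ' / (((2 * n + 1) * Real.pi / β) ^ 2 + ξ' ^ 2)| =
          |ξ'| * (2 * (1 / (((2 * n + 1) * Real.pi / β) ^ 2 + ξ' ^ 2))) := by
        intro n _
        have hD : (0 : ℝ) < ((2 * n + 1) * Real.pi / β) ^ 2 + ξ' ^ 2 := by positivity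
        rw [abs_div, abs_of_pos hD, abs_mul, abs_two]
        field_simp
      rw [sum_congr rfl habs, ← mul_sum, ← mul_sum, ← sum_matsubaraIdx_one_div_sq_add_sq β ξ' M]
      have h := sum_matsubaraIdx_inv_sq_add_sq_le hβ (abs_pos.2 hξ0) M
      simp_rw [sq_abs] at h
      calc |ξ'| * ∑ i : MatsubaraIdx M, 1 / (matsubaraFreq β M i ^ 2 + ξ' ^ 2) ≤ |ξ'| * (β / (2 * |ξ'|)) :=
            mul_le_mul_of_nonneg_left h (abs_nonneg _)
        _ = β / 2 := by field_simp
  -- sum over momenta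
  have hkv : ∀ kv : TorusSite 2 L,
      ‖∑ i : MatsubaraIdx M, ((1 / (β * (L : ℝ) ^ 2) : ℝ) : ℂ) / (-I * (matsubaraFreq β M i : ℂ) + (nambuXi L μ kv : ℂ) - (s₁ : ℂ))‖ ≤
        1 / (β * (L : ℝ) ^ 2) * (β / 2) := by
    intro kv
    simp_rw [div_eq_mul_one_div (((1 / (β * (L : ℝ) ^ 2) : ℝ) : ℂ))]
    rw [← mul_sum, norm_mul, hc]
    exact mul_le_mul_of_nonneg_left (hfreq kv) (by positivity)
  unfold totalTadpole
  rw [norm_neg, Fintype.sum_prod_type, sum_comm]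
  refine (norm_sum_le _ _).trans ((sum_le_sum fun kv _ => hkv kv).trans (le_of_eq ?_))
  rw [sum_const, card_univ, Fintype.card_fun, ZMod.card, Fintype.card_fin, nsmul_eq_mul]
  push_cast
  field_simp

/-! ### The derivative and its bound -/

/-- **`T` is complex differentiable in the strip**, `T′ = totalTadpoleDeriv`. [cite: BenfattoGiulianiMastropietro2006, §2.3 (2.21)-(2.22)] -/
theorem hasDerivAt_totalTadpole {β : ℝ} (hβ : 0 < β) (μ : ℝ) {s : ℂ} (hs : |s.im| < Real.pi / β) :
    HasDerivAt (totalTadpole L M β μ) (totalTadpoleDeriv L M β μ s) s := by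
  set c : ℂ := ((1 / (β * (L : ℝ) ^ 2) : ℝ) : ℂ) with hc
  have hterm : ∀ k : FreqMomentum L M, HasDerivAt
      (fun z : ℂ => c / (-I * (matsubaraFreq β M k.1 : ℂ) + (nambuXi L μ k.2 : ℂ) - z))
      (c / (-I * (matsubaraFreq β M k.1 : ℂ) + (nambuXi L μ k.2 : ℂ) - s) ^ 2) s := by
    intro k
    have hne := totalDen_ne_zero (L := L) (M := M) hβ μ hs k
    set d : ℂ := -I * (matsubaraFreq β M k.1 : ℂ) + (nambuXi L μ k.2 : ℂ) with hd
    have h1 : HasDerivAt (fun z : ℂ => d - z) (-1) s := by simpa using (hasDerivAt_id s).const_sub d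
    have h2 := (h1.inv hne).const_mul c
    have h3 : c * (-(-1 : ℂ) / (d - s) ^ 2) = c / (d - s) ^ 2 := by field_simp
    rw [h3] at h2
    refine h2.congr_of_eventuallyEq (Filter.Eventually.of_forall fun z => ?_)
    simp [div_eq_mul_inv]
  have hsum : HasDerivAt (fun z : ℂ => ∑ k : FreqMomentum L M, c / (-I * (matsubaraFreq β M k.1 : ℂ) + (nambuXi L μ k.2 : ℂ) - z))
      (∑ k : FreqMomentum L M, c / (-I * (matsubaraFreq β M k.1 : ℂ) + (nambuXi L μ k.2 : ℂ) - s) ^ 2) s :=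
    by simpa [Finset.sum_fn] using (HasDerivAt.sum (u := (univ : Finset (FreqMomentum L M))) fun k _ => hterm k)
  have key : totalTadpole L M β μ = fun z : ℂ =>
      -∑ k : FreqMomentum L M, c / (-I * (matsubaraFreq β M k.1 : ℂ) + (nambuXi L μ k.2 : ℂ) - z) := by
    funext z; rfl
  rw [key, totalTadpoleDeriv]
  exact hsum.neg

omit [NeZero L] in
/-- In the closed quarter-strip `|Im s| ≤ π/(4β)` the squared denominators dominate `(9/16)(ω² + ξ′²)`, `ξ′ = ξ_μ - Re s`.
[cite: BenfattoGiulianiMastropietro2006, §2.1 (2.3)] -/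
theorem norm_sq_totalDen_ge {β : ℝ} (hβ : 0 < β) (μ : ℝ) {s : ℂ} (hs : |s.im| ≤ Real.pi / (4 * β)) (k : FreqMomentum L M) :
    9 / 16 * (matsubaraFreq β M k.1 ^ 2 + (nambuXi L μ k.2 - s.re) ^ 2) ≤
      ‖-I * (matsubaraFreq β M k.1 : ℂ) + (nambuXi L μ k.2 : ℂ) - s‖ ^ 2 := by
  have hω := pi_div_le_abs_matsubaraFreq hβ k.1
  have him : |s.im| ≤ |matsubaraFreq β M k.1| / 4 := by
    refine hs.trans ?_
    rw [div_le_div_iff₀ (by positivity) (by norm_num : (0:ℝ) < 4)]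
    have := (div_le_iff₀ hβ).1 hω
    nlinarith
  rw [Complex.sq_norm, Complex.normSq_apply]
  simp only [sub_re, add_re, neg_mul, neg_re, mul_re, I_re, ofReal_re, zero_mul, I_im, ofReal_im, mul_zero, sub_zero,
    sub_im, add_im, neg_im, mul_im, one_mul, zero_add, add_zero]
  rw [abs_le] at him
  have h1 := abs_nonneg (matsubaraFreq β M k.1)
  rcases le_or_gt 0 (matsubaraFreq β M k.1) with h | h
  · rw [abs_of_nonneg h] at him; nlinarith
  · rw [abs_of_neg h] at him; nlinarith

/-- **The derivative bound before counting**: `‖T′(s)‖ ≤ (16/9) L⁻² Σ_{k⃗} shellWeight(k⃗)` at the shifted band `ξ_{μ + Re s}`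
(`|Im s| ≤ π/(4β)`): `Σ_n 1/(ω_n²+ξ′²) ≤ min(β/(2|ξ′|), β²/3)`. [cite: BenfattoGiulianiMastropietro2006, §2.1 (2.2)-(2.5)] -/
theorem norm_totalTadpoleDeriv_le {β : ℝ} (hβ : 0 < β) (μ : ℝ) {s : ℂ} (hs : |s.im| ≤ Real.pi / (4 * β)) :
    ‖totalTadpoleDeriv L M β μ s‖ ≤ 16 / 9 * (1 / (L : ℝ) ^ 2 * ∑ kv : TorusSite 2 L, shellWeight L β (μ + s.re) kv) := by
  have hL : (0 : ℝ) < L := by exact_mod_cast Nat.pos_of_ne_zero (NeZero.ne L)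
  have hc : ‖((1 / (β * (L : ℝ) ^ 2) : ℝ) : ℂ)‖ = 1 / (β * (L : ℝ) ^ 2) := by
    rw [Complex.norm_real, Real.norm_eq_abs, abs_of_pos (by positivity)]
  -- termwise
  have hterm : ∀ k : FreqMomentum L M,
      ‖((1 / (β * (L : ℝ) ^ 2) : ℝ) : ℂ) / (-I * (matsubaraFreq β M k.1 : ℂ) + (nambuXi L μ k.2 : ℂ) - s) ^ 2‖ ≤
        1 / (β * (L : ℝ) ^ 2) * (16 / 9 * (1 / (matsubaraFreq β M k.1 ^ 2 + (nambuXi L μ k.2 - s.re) ^ 2))) := by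
    intro k
    have hden := norm_sq_totalDen_ge (L := L) (M := M) hβ μ hs k
    have hpos : 0 < matsubaraFreq β M k.1 ^ 2 + (nambuXi L μ k.2 - s.re) ^ 2 := by
      have := matsubaraFreq_ne_zero (M := M) hβ.ne' k.1; positivity
    have hden0 : 0 < ‖-I * (matsubaraFreq β M k.1 : ℂ) + (nambuXi L μ k.2 : ℂ) - s‖ ^ 2 := lt_of_lt_of_le (by positivity) hden
    rw [norm_div, norm_pow, hc, div_eq_mul_one_div]
    refine mul_le_mul_of_nonneg_left ?_ (by positivity)
    rw [mul_one_div, div_le_div_iff₀ hden0 hpos]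
    nlinarith
  unfold totalTadpoleDeriv
  rw [norm_neg]
  refine (norm_sum_le _ _).trans ((sum_le_sum fun k _ => hterm k).trans ?_)
  rw [Fintype.sum_prod_type, sum_comm]
  -- the frequency sums
  have hfreq : ∀ kv : TorusSite 2 L, ∑ i : MatsubaraIdx M, 1 / (β * (L : ℝ) ^ 2) *
      (16 / 9 * (1 / (matsubaraFreq β M i ^ 2 + (nambuXi L μ kv - s.re) ^ 2))) ≤
        16 / 9 * (1 / (L : ℝ) ^ 2 * shellWeight L β (μ + s.re) kv) := by
    intro kv
    rw [← mul_sum, ← mul_sum]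
    have hξ : nambuXi L (μ + s.re) kv = nambuXi L μ kv - s.re := by simp only [nambuXi]; ring
    have hS : ∑ i : MatsubaraIdx M, 1 / (matsubaraFreq β M i ^ 2 + (nambuXi L μ kv - s.re) ^ 2) ≤ β * shellWeight L β (μ + s.re) kv := by
      rw [shellWeight, hξ]
      split_ifs with hsmall
      · calc _ ≤ ∑ i : MatsubaraIdx M, 1 / matsubaraFreq β M i ^ 2 :=
              sum_le_sum fun i _ => one_div_le_one_div_of_le (by have := matsubaraFreq_ne_zero (M := M) hβ.ne' i; positivity)
                (by nlinarith)
          _ ≤ β ^ 2 / 3 := sum_matsubaraIdx_one_div_sq_le hβ M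
          _ = β * (β / 3) := by ring
      · have hξ0 : 0 < |nambuXi L μ kv - s.re| := by
          rw [not_lt] at hsmall; exact lt_of_lt_of_le (by positivity) hsmall
        have h := sum_matsubaraIdx_inv_sq_add_sq_le hβ hξ0 M
        simp_rw [sq_abs] at h
        calc _ ≤ β / (2 * |nambuXi L μ kv - s.re|) := h
          _ = β * (1 / (2 * |nambuXi L μ kv - s.re|)) := by ring
    calc 1 / (β * (L : ℝ) ^ 2) * (16 / 9 * ∑ i : MatsubaraIdx M, 1 / (matsubaraFreq β M i ^ 2 + (nambuXi L μ kv - s.re) ^ 2))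
        ≤ 1 / (β * (L : ℝ) ^ 2) * (16 / 9 * (β * shellWeight L β (μ + s.re) kv)) :=
          mul_le_mul_of_nonneg_left (mul_le_mul_of_nonneg_left hS (by norm_num)) (by positivity)
      _ = 16 / 9 * (1 / (L : ℝ) ^ 2 * shellWeight L β (μ + s.re) kv) := by field_simp
  refine (sum_le_sum fun kv _ => hfreq kv).trans (le_of_eq ?_)
  rw [← mul_sum, ← mul_sum]

/-! ### Counting: the logarithm -/

/-- `shellWeight ≥ 0`. [cite: BenfattoGiulianiMastropietro2006, §2.1 (2.2)-(2.5)] -/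
theorem shellWeight_nonneg {β : ℝ} (hβ : 0 < β) (μ : ℝ) (k : TorusSite 2 L) : 0 ≤ shellWeight L β μ k := by
  unfold shellWeight; split_ifs <;> positivity

/-- **The momentum sum of the weights**: for `μ` at distance `≥ d₀` from `{-4, 0}` and `3/d₀ ≤ β`,
`L⁻² Σ_{k⃗} shellWeight(k⃗) ≤ 1/d₀ + (4 (log(d₀β/3)/log 2 + 2) + 2)/c_{d₀} + (20/3) β/L`, `c_{d₀} = 2π√(d₀/8)` (dyadic shells
`(d₀/2)2^{-i-1} ≤ |ξ| < (d₀/2)2^{-i}` down to `3/(2β)`, each counted by `card_torusShell_le`).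
[cite: BenfattoGiulianiMastropietro2006, §2.1 (2.2)-(2.5)] -/
theorem shellWeightSum_le {β μ d₀ : ℝ} (hd₀ : 0 < d₀) (hμ4 : d₀ ≤ μ + 4) (hμ0 : d₀ ≤ -μ) (hβ : 3 / d₀ ≤ β) :
    1 / (L : ℝ) ^ 2 * ∑ kv : TorusSite 2 L, shellWeight L β μ kv ≤
      1 / d₀ + (4 * (Real.log (d₀ * β / 3) / Real.log 2 + 2) + 2) / (2 * Real.pi * Real.sqrt (d₀ / 8)) + 20 / 3 * (β / L) := by
  classical
  have hβ0 : 0 < β := lt_of_lt_of_le (by positivity) hβ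
  have hβd : 3 ≤ d₀ * β := by have := (div_le_iff₀ hd₀).1 hβ; linarith
  have hL : (0 : ℝ) < L := by exact_mod_cast Nat.pos_of_ne_zero (NeZero.ne L)
  set cd : ℝ := 2 * Real.pi * Real.sqrt (d₀ / 8) with hcd
  have hcd0 : 0 < cd := by rw [hcd]; positivity
  -- the dyadic scales and the number of shells
  set η : ℕ → ℝ := fun i => d₀ / 2 / 2 ^ i with hη
  have hη0 : ∀ i, 0 < η i := fun i => by simp only [hη]; positivity
  have hηd : ∀ i, η i ≤ d₀ / 2 := fun i => by
    simp only [hη]; exact div_le_self (by positivity) (one_le_pow₀ (by norm_num))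
  have hηsucc : ∀ i, η (i + 1) = η i / 2 := fun i => by simp only [hη, pow_succ]; field_simp
  have hex : ∃ I : ℕ, η I ≤ 3 / (2 * β) := by
    obtain ⟨I, hI⟩ := pow_unbounded_of_one_lt (d₀ / 2 / (3 / (2 * β))) (by norm_num : (1 : ℝ) < 2)
    refine ⟨I, ?_⟩
    simp only [hη]
    rw [div_le_iff₀ (by positivity)]
    have := (div_lt_iff₀ (by positivity : (0:ℝ) < 3 / (2 * β))).1 hI
    linarith
  set I := Nat.find hex with hIdef
  have hI : η I ≤ 3 / (2 * β) := Nat.find_spec hex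
  have hbelow : ∀ i, i < I → 3 / (2 * β) < η i := fun i hi => not_le.1 (Nat.find_min hex hi)
  have h2I : (2 : ℝ) ^ I ≤ 2 * (d₀ * β / 3) := by
    rcases Nat.eq_zero_or_pos I with h0 | hpos
    · rw [h0, pow_zero]; linarith
    · have h := hbelow (I - 1) (by omega)
      simp only [hη] at h
      rw [lt_div_iff₀ (by positivity), div_mul_eq_mul_div, div_lt_iff₀ (by positivity)] at h
      have h2 : (2 : ℝ) ^ I = 2 * 2 ^ (I - 1) := by rw [← pow_succ']; congr 1; omega
      rw [h2]; nlinarith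
  have hIlog : (I : ℝ) ≤ Real.log (d₀ * β / 3) / Real.log 2 + 2 := by
    have hlog2 : 0 < Real.log 2 := Real.log_pos (by norm_num)
    have h := Real.log_le_log (by positivity) h2I
    rw [Real.log_pow, Real.log_mul (by norm_num) (by positivity)] at h
    have : (I : ℝ) ≤ Real.log (d₀ * β / 3) / Real.log 2 + 1 := by
      rw [div_add_one hlog2.ne', le_div_iff₀ hlog2]; linarith
    linarith
  -- pointwise bound by indicators of the cumulative shells
  have hpt : ∀ kv : TorusSite 2 L, shellWeight L β μ kv ≤
      1 / d₀ + (∑ i ∈ range I, if |nambuXi L μ kv| < η i then (2 : ℝ) ^ (i + 1) / d₀ else 0) +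
        (if |nambuXi L μ kv| < η I then β / 3 else 0) := by
    intro kv
    set a := |nambuXi L μ kv| with ha
    have ha0 : 0 ≤ a := abs_nonneg _
    have hsum0 : 0 ≤ ∑ i ∈ range I, (if a < η i then (2 : ℝ) ^ (i + 1) / d₀ else 0) :=
      sum_nonneg fun i _ => by split_ifs <;> positivity
    have hval_le : ∀ b : ℝ, 0 < b → b ≤ a → b ≤ 3 / (2 * β) ∨ True →
        (if a < 3 / (2 * β) then β / 3 else 1 / (2 * a)) ≤ 1 / (2 * b) := by
      -- if `b ≤ a` then the value is at most `1/(2b)` provided `b ≤ 3/(2β)` in the first branch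
      intro b hb hba _
      split_ifs with h
      · have : b < 3 / (2 * β) := lt_of_le_of_lt hba h
        rw [lt_div_iff₀ (by positivity)] at this
        rw [div_le_div_iff₀ (by norm_num) (by positivity)]
        nlinarith
      · exact div_le_div_of_nonneg_left (by norm_num) (by positivity) (by nlinarith)
    unfold shellWeight
    rw [← ha]
    by_cases hin : a < η I
    · -- innermost
      rw [if_pos hin]
      have : (if a < 3 / (2 * β) then β / 3 else 1 / (2 * a)) ≤ β / 3 := by
        split_ifs with h
        · exact le_rfl
        · rw [not_lt] at h
          have ha' : 0 < a := lt_of_lt_of_le (by positivity) h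
          rw [div_le_div_iff₀ (by positivity) (by norm_num)]; nlinarith
      linarith [this, show (0:ℝ) ≤ 1 / d₀ by positivity]
    · rw [if_neg hin, add_zero]
      rw [not_lt] at hin
      by_cases hout : η 0 ≤ a
      · -- outside all shells
        have h1 : (if a < 3 / (2 * β) then β / 3 else 1 / (2 * a)) ≤ 1 / (2 * η 0) := hval_le (η 0) (hη0 0) hout (Or.inr trivial)
        have h2 : 1 / (2 * η 0) = 1 / d₀ := by simp only [hη, pow_zero, div_one]; field_simp
        linarith
      · rw [not_le] at hout
        -- the first scale below which `a` is not: `m = Nat.find`, `1 ≤ m ≤ I`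
        have hexm : ∃ m, ¬ a < η m := ⟨I, not_lt.2 hin⟩
        set m := Nat.find hexm with hmdef
        have hm : ¬ a < η m := Nat.find_spec hexm
        have hm0 : m ≠ 0 := fun h => by rw [h] at hm; exact hm hout
        have hmI : m ≤ I := Nat.find_min' hexm (not_lt.2 hin)
        have hprev : a < η (m - 1) := by
          have := Nat.find_min hexm (show m - 1 < m by omega); simpa using this
        have hterm : (2 : ℝ) ^ (m - 1 + 1) / d₀ ≤ ∑ i ∈ range I, (if a < η i then (2 : ℝ) ^ (i + 1) / d₀ else 0) := by
          rw [← Finset.sum_erase_add _ _ (mem_range.2 (show m - 1 < I by omega)), if_pos hprev]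
          have : 0 ≤ ∑ i ∈ (range I).erase (m - 1), (if a < η i then (2 : ℝ) ^ (i + 1) / d₀ else 0) :=
            sum_nonneg fun i _ => by split_ifs <;> positivity
          linarith
        have hval : (if a < 3 / (2 * β) then β / 3 else 1 / (2 * a)) ≤ (2 : ℝ) ^ (m - 1 + 1) / d₀ := by
          have h1 := hval_le (η m) (hη0 m) (not_lt.1 hm) (Or.inr trivial)
          have h2 : 1 / (2 * η m) = (2 : ℝ) ^ (m - 1 + 1) / d₀ := by
            rw [show m - 1 + 1 = m by omega]
            simp only [hη]
            field_simp
          linarith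
        linarith [show (0:ℝ) ≤ 1 / d₀ by positivity]
  -- sum the pointwise bound and count
  have hcount : ∀ i, i ≤ I → (((univ : Finset (TorusSite 2 L)).filter fun kv => |nambuXi L μ kv| < η i).card : ℝ) ≤
      4 * (L * (η i * L / cd + 1)) := fun i _ => card_torusShell_le hμ4 hμ0 (hη0 i) (hηd i)
  have hsum_ind : ∀ (i : ℕ) (v : ℝ), 0 ≤ v → i ≤ I →
      ∑ kv : TorusSite 2 L, (if |nambuXi L μ kv| < η i then v else 0) ≤ v * (4 * (L * (η i * L / cd + 1))) := by
    intro i v hv hi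
    rw [← sum_filter, sum_const, nsmul_eq_mul, mul_comm]
    exact mul_le_mul_of_nonneg_left (hcount i hi) hv
  have hS : ∑ kv : TorusSite 2 L, shellWeight L β μ kv ≤
      (L : ℝ) ^ 2 / d₀ + (4 * (L : ℝ) ^ 2 * I / cd + 16 * L * β / 3) + (2 * (L : ℝ) ^ 2 / cd + 4 * L * β / 3) := by
    refine (sum_le_sum fun kv _ => hpt kv).trans ?_
    rw [sum_add_distrib, sum_add_distrib, sum_const, card_univ, Fintype.card_fun, ZMod.card, Fintype.card_fin, nsmul_eq_mul,
      sum_comm]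
    push_cast
    refine add_le_add (add_le_add (le_of_eq (by ring)) ?_) ?_
    · -- the dyadic shells
      have hshell : ∀ i ∈ range I, ∑ kv : TorusSite 2 L, (if |nambuXi L μ kv| < η i then (2 : ℝ) ^ (i + 1) / d₀ else 0) ≤
          4 * (L : ℝ) ^ 2 / cd + 8 * L * 2 ^ i / d₀ := by
        intro i hi
        refine (hsum_ind i _ (by positivity) (mem_range.1 hi).le).trans (le_of_eq ?_)
        have h1 : (2 : ℝ) ^ (i + 1) * η i / d₀ = 1 := by
          simp only [hη, pow_succ]; field_simp
        calc (2 : ℝ) ^ (i + 1) / d₀ * (4 * (L * (η i * L / cd + 1)))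
            = 4 * (L : ℝ) ^ 2 / cd * ((2 : ℝ) ^ (i + 1) * η i / d₀) + 4 * L * (2 ^ (i + 1)) / d₀ := by ring
          _ = 4 * (L : ℝ) ^ 2 / cd + 8 * L * 2 ^ i / d₀ := by rw [h1, pow_succ]; ring
      refine (sum_le_sum hshell).trans ?_
      rw [sum_add_distrib, sum_const, card_range, nsmul_eq_mul]
      have hsum2 : ∑ x ∈ range I, 8 * (L : ℝ) * 2 ^ x / d₀ = 8 * L * (∑ x ∈ range I, (2 : ℝ) ^ x) / d₀ := by
        rw [Finset.mul_sum, Finset.sum_div]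
      rw [hsum2]
      have hgeom : ∑ i ∈ range I, (2 : ℝ) ^ i ≤ 2 ^ I := by
        have := geom_sum_eq (x := (2 : ℝ)) (by norm_num) I
        rw [this]; norm_num
      have : 8 * (L : ℝ) * (∑ i ∈ range I, (2 : ℝ) ^ i) / d₀ ≤ 16 * L * β / 3 := by
        rw [div_le_iff₀ hd₀]
        nlinarith [hgeom, h2I, hL]
      have hI4 : (I : ℝ) * (4 * (L : ℝ) ^ 2 / cd) = 4 * (L : ℝ) ^ 2 * I / cd := by ring
      linarith [this, hI4]
    · -- the innermost disc
      refine (hsum_ind I _ (by positivity) le_rfl).trans ?_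
      have hI' : η I * L / cd ≤ 3 / (2 * β) * L / cd := by gcongr
      calc β / 3 * (4 * (L * (η I * L / cd + 1))) ≤ β / 3 * (4 * (L * (3 / (2 * β) * L / cd + 1))) := by gcongr
        _ = 2 * (L : ℝ) ^ 2 / cd + 4 * L * β / 3 := by field_simp; ring
  -- divide by `L²`
  rw [one_div, inv_mul_le_iff₀ (by positivity)]
  refine hS.trans ?_
  have hIlog' : 4 * (L : ℝ) ^ 2 * I / cd ≤ 4 * (L : ℝ) ^ 2 * (Real.log (d₀ * β / 3) / Real.log 2 + 2) / cd := by gcongr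
  have hexp : (L : ℝ) ^ 2 * (1 / d₀ + (4 * (Real.log (d₀ * β / 3) / Real.log 2 + 2) + 2) / cd + 20 / 3 * (β / L)) =
      (L : ℝ) ^ 2 / d₀ + (4 * (L : ℝ) ^ 2 * (Real.log (d₀ * β / 3) / Real.log 2 + 2) / cd + 16 * L * β / 3) +
        (2 * (L : ℝ) ^ 2 / cd + 4 * L * β / 3) := by
    field_simp; ring
  rw [hexp]
  linarith [hIlog']

/-- **The Lipschitz bound of the total tadpole in the box** `|Re| ≤ δ`, `|Im| ≤ π/(4β)`: for `μ` with margin `d₀ + δ` from `{-4, 0}`,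
`3/d₀ ≤ β`, and any two shifts `s, s′` in the box,
`‖T(s) - T(s′)‖ ≤ (16/9)(1/d₀ + (4(log(d₀β/3)/log 2 + 2) + 2)/c_{d₀} + (20/3)β/L) · ‖s - s′‖`.
[cite: BenfattoGiulianiMastropietro2006, §2.3 (2.21)-(2.24)] -/
theorem norm_totalTadpole_sub_le {β μ d₀ δ : ℝ} (hd₀ : 0 < d₀) (hμ4 : d₀ + δ ≤ μ + 4) (hμ0 : d₀ + δ ≤ -μ)
    (hβ : 3 / d₀ ≤ β) {s s' : ℂ} (hs : |s.re| ≤ δ) (hsi : |s.im| ≤ Real.pi / (4 * β)) (hs' : |s'.re| ≤ δ)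
    (hsi' : |s'.im| ≤ Real.pi / (4 * β)) :
    ‖totalTadpole L M β μ s - totalTadpole L M β μ s'‖ ≤
      16 / 9 * (1 / d₀ + (4 * (Real.log (d₀ * β / 3) / Real.log 2 + 2) + 2) / (2 * Real.pi * Real.sqrt (d₀ / 8)) +
        20 / 3 * (β / L)) * ‖s - s'‖ := by
  have hβ0 : 0 < β := lt_of_lt_of_le (by positivity) hβ
  -- the box is convex and the derivative is bounded on it
  set B : Set ℂ := {z : ℂ | |z.re| ≤ δ ∧ |z.im| ≤ Real.pi / (4 * β)} with hB
  have hconv : Convex ℝ B := by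
    have h1 : B = (Complex.re ⁻¹' Set.Icc (-δ) δ) ∩ (Complex.im ⁻¹' Set.Icc (-(Real.pi / (4 * β))) (Real.pi / (4 * β))) := by
      ext z; simp [hB, abs_le]
    rw [h1]
    exact ((convex_Icc _ _).linear_preimage Complex.reLm).inter ((convex_Icc _ _).linear_preimage Complex.imLm)
  have hstrip : ∀ z ∈ B, |z.im| < Real.pi / β := by
    intro z hz
    refine lt_of_le_of_lt hz.2 ?_
    rw [div_lt_div_iff₀ (by positivity) hβ0]; nlinarith [Real.pi_pos]
  have hderiv : ∀ z ∈ B, HasDerivWithinAt (totalTadpole L M β μ) (totalTadpoleDeriv L M β μ z) B z :=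
    fun z hz => (hasDerivAt_totalTadpole hβ0 μ (hstrip z hz)).hasDerivWithinAt
  have hbound : ∀ z ∈ B, ‖totalTadpoleDeriv L M β μ z‖ ≤
      16 / 9 * (1 / d₀ + (4 * (Real.log (d₀ * β / 3) / Real.log 2 + 2) + 2) / (2 * Real.pi * Real.sqrt (d₀ / 8)) +
        20 / 3 * (β / L)) := by
    intro z hz
    refine (norm_totalTadpoleDeriv_le hβ0 μ hz.2).trans (mul_le_mul_of_nonneg_left ?_ (by norm_num))
    have hz1 := hz.1
    rw [abs_le] at hz1
    exact shellWeightSum_le hd₀ (by linarith) (by linarith) hβ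
  exact hconv.norm_image_sub_le_of_norm_hasDerivWithin_le hderiv hbound ⟨hs', hsi'⟩ ⟨hs, hsi⟩

end Literature.MathematicalPhysics.QuantumLattice

end
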